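import Mathlib
import Summits.MatrixMultiplication.MatrixMultiplication.Theorems.SnSubsetDichotomyHyperoctahedralThresholdStubPatternTwin

/-!
# `SnSubsetDichotomy.HyperoctahedralThreshold` — half-turn-symmetric patterns give clean closed rung walks

Helper for crux `stmt-MatrixMultiplication-10883` (line `refutation-local-symmetry`, open core
`stub_poorRigidCore`; siege seat k20).  Companion of the landed `stub_patternTwin` (p107640, twin type)
and of `patternRefl_cleanWalk` (reflection type, sibling file
`SnSubsetDichotomyHyperoctahedralThresholdPatternRefl`), for the third clean shape of `stub_extract`:

* `patternHalfTurn_cleanWalk` (Möbius / antipodal type, ONE fixed point).  Vocabulary of the line: three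
  involutions `μ c` of `Fin n`, a colour word `z` acting on the right by `z.foldl (fun v c => μ c v)`,
  trajectory `t ↦ x · z.take t` of a fixed point `x`, self-coincidence pattern = the relation
  `x · z.take s = x · z.take t`.  If `z` is a SQUARE word (`z[t] = z[(t + L) % ℓ]`, `ℓ = 2L`, i.e.
  `z = w ++ w`, `halfTurnForm_symm`) and the pattern of the fixed point `x` of `z` is invariant under the
  half turn `t ↦ (t + L) % ℓ` and never identifies antipodes (`x · z.take t ≠ x · z.take ((t + L) % ℓ)`;
  otherwise `x · z.take t` is already a fixed point of a rotation of the half word `w`), then the rung walk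
  `t ↦ {x · z.take t, x · z.take (t + L)}`, `t < L`, closed by a side-SWAPPING step, is clean closed-walk
  data in the exact output format of the core with `2 (k + 1) = ℓ`.

Pure finite combinatorics; reuses `GoodTwin.foldl_take_step` / `GoodTwin.cyclic_ne` (p99339). [folklore]
-/

-- the project's summit namespace `Summit.MatrixMultiplication.MatrixMultiplication` repeats a component by design (D-0022)
set_option linter.dupNamespace false

namespace Summit.MatrixMultiplication.MatrixMultiplication.Theorems.HyperoctahedralThreshold

open Equiv

namespace PatternHalfTurn

/-- **Letters of a square word.**  `z = w ++ w` is half-turn-symmetric: `z[t] = z[(t + |w|) % ℓ]`.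
[folklore] -/
theorem halfTurnForm_symm (w : List (Fin 3)) (t : ℕ) (ht : t < (w ++ w).length) :
    (w ++ w)[t] = (w ++ w)[(t + w.length) % (w ++ w).length]'(Nat.mod_lt _ (by omega)) := by
  have hL : (w ++ w).length = w.length + w.length := List.length_append
  have hσ : (t + w.length) % (w ++ w).length < (w ++ w).length := Nat.mod_lt _ (by omega)
  have key : (w ++ w)[t]? = (w ++ w)[(t + w.length) % (w ++ w).length]? := by
    rw [hL] at ht ⊢
    rcases Nat.lt_or_ge t w.length with h1 | h1
    · rw [Nat.mod_eq_of_lt (by omega), List.getElem?_append_left h1,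
        List.getElem?_append_right (by omega), Nat.add_sub_cancel]
    · obtain ⟨s, rfl⟩ : ∃ s, t = w.length + s := ⟨t - w.length, by omega⟩
      rw [show w.length + s + w.length = s + (w.length + w.length) by omega, Nat.add_mod_right,
        Nat.mod_eq_of_lt (by omega), List.getElem?_append_right (by omega),
        Nat.add_sub_cancel_left, List.getElem?_append_left (by omega)]
  rw [List.getElem?_eq_getElem ht, List.getElem?_eq_getElem hσ] at key
  exact Option.some.inj key

end PatternHalfTurn

open PatternHalfTurn in
/-- **A fixed point with half-turn-symmetric pattern gives a clean closed rung walk** (Möbius /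
antipodal type; companion of the landed `stub_patternTwin`).  Let `μ c` be involutions of `Fin n`,
`z` a cyclically reduced colour word of length `ℓ = 2L ≥ 2` that is half-turn-symmetric
(`z[t] = z[(t + L) % ℓ]`, i.e. `z = w ++ w`, `halfTurnForm_symm`), and `x` a fixed point of `z` whose
trajectory avoids `R`, whose self-coincidence pattern is invariant under the half turn `t ↦ (t + L) % ℓ`,
and which is never antipodal to itself (`x · z.take t ≠ x · z.take ((t + L) % ℓ)`; otherwise `x · z.take t`
is already a fixed point of a rotation of the half word).  Then `p t := x · z.take t`,
`q t := x · z.take (t + L)`, `col t := z[t]` on `Fin (k + 1)`, `k + 1 = L`, is clean closed-walk data in the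
output format of the core: side-preserving steps for `t + 1 < L` and a side-SWAPPING closing step
(`GoodTwin.foldl_take_step` and `z[t + L] = z[t]`), cyclically distinct consecutive colours
(`GoodTwin.cyclic_ne` and `z[L] = z[0]`), pairwise equal-or-disjoint rungs (pattern symmetry and
`(t + 2L) % ℓ = t`), all points outside `R`. [folklore] -/
theorem patternHalfTurn_cleanWalk (n : ℕ) (μ : Fin 3 → Equiv.Perm (Fin n)) (R : Finset (Fin n))
    (z : List (Fin 3)) (L : ℕ) (x : Fin n) (hL : z.length = 2 * L) (hlen : 2 ≤ z.length)
    (hchain : List.IsChain (· ≠ ·) (z ++ z))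
    (hsym : ∀ t (ht : t < z.length), z[t] = z[(t + L) % z.length]'(Nat.mod_lt _ (by omega)))
    (hfix : z.foldl (fun v c => μ c v) x = x)
    (hpat : ∀ s t : Fin z.length,
      ((z.take (s : ℕ)).foldl (fun v c => μ c v) x = (z.take (t : ℕ)).foldl (fun v c => μ c v) x ↔
        (z.take (((s : ℕ) + L) % z.length)).foldl (fun v c => μ c v) x =
          (z.take (((t : ℕ) + L) % z.length)).foldl (fun v c => μ c v) x))
    (hapart : ∀ t : Fin z.length, (z.take (t : ℕ)).foldl (fun v c => μ c v) x ≠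
      (z.take (((t : ℕ) + L) % z.length)).foldl (fun v c => μ c v) x)
    (hR : ∀ t : Fin z.length, (z.take (t : ℕ)).foldl (fun v c => μ c v) x ∉ R) :
    ∃ (k : ℕ) (p q : Fin (k + 1) → Fin n) (col : Fin (k + 1) → Fin 3), (∀ i, p i ≠ q i) ∧
      (∀ i, (μ (col i) (p i) = p (i + 1) ∧ μ (col i) (q i) = q (i + 1)) ∨
        (μ (col i) (p i) = q (i + 1) ∧ μ (col i) (q i) = p (i + 1))) ∧
      (∀ i, col i ≠ col (i + 1)) ∧
      (∀ i j, (p i = p j ∧ q i = q j) ∨ (p i = q j ∧ q i = p j) ∨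
        (p i ≠ p j ∧ p i ≠ q j ∧ q i ≠ p j ∧ q i ≠ q j)) ∧
      (∀ i, p i ∉ R ∧ q i ∉ R) ∧ 2 * (k + 1) = z.length := by
  classical
  obtain ⟨k, hk⟩ : ∃ k, k + 1 = L := ⟨L - 1, by omega⟩
  -- index bookkeeping on `Fin (k + 1) = Fin L` inside `Fin ℓ`, `ℓ = 2L`
  have hlt : ∀ i : Fin (k + 1), (i : ℕ) < z.length := fun i => by have := i.isLt; omega
  have hltL : ∀ i : Fin (k + 1), (i : ℕ) + L < z.length := fun i => by have := i.isLt; omega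
  have hmodL : ∀ i : Fin (k + 1), ((i : ℕ) + L) % z.length = (i : ℕ) + L :=
    fun i => Nat.mod_eq_of_lt (hltL i)
  have hmod2L : ∀ i : Fin (k + 1), ((i : ℕ) + L + L) % z.length = (i : ℕ) :=
    fun i => by
      rw [show (i : ℕ) + L + L = (i : ℕ) + z.length by omega, Nat.add_mod_right]
      exact Nat.mod_eq_of_lt (hlt i)
  have hval : ∀ i : Fin (k + 1), ((i + 1 : Fin (k + 1)) : ℕ) = ((i : ℕ) + 1) % L :=
    fun i => by
      rw [PatternTwin.val_add_one]
      exact congrArg (fun N => ((i : ℕ) + 1) % N) hk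
  refine ⟨k, fun i => (z.take i).foldl (fun v c => μ c v) x,
    fun i => (z.take ((i : ℕ) + L)).foldl (fun v c => μ c v) x,
    fun i => z[(i : ℕ)]'(hlt i), ?_, ?_, ?_, ?_, ?_, by omega⟩
  · -- the two ends of every rung differ: `x` is never antipodal to itself
    intro i
    have h := hapart ⟨i, hlt i⟩
    rwa [hmodL i] at h
  · -- steps: side-preserving inside, side-swapping at the closing step `L - 1 → 0`
    intro i
    have hp := GoodTwin.foldl_take_step μ z x hfix i (hlt i)
    have hq := GoodTwin.foldl_take_step μ z x hfix ((i : ℕ) + L) (hltL i)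
    have hzL : z[(i : ℕ) + L]'(hltL i) = z[(i : ℕ)]'(hlt i) := by
      rw [hsym i (hlt i)]; simp only [hmodL i]
    rw [hzL] at hq
    rcases (show (i : ℕ) + 1 < L ∨ (i : ℕ) + 1 = L by have := i.isLt; omega) with h1 | h1
    · refine Or.inl ⟨?_, ?_⟩
      · show μ (z[(i : ℕ)]'(hlt i)) ((z.take i).foldl (fun v c => μ c v) x) =
          (z.take ((i + 1 : Fin (k + 1)) : ℕ)).foldl (fun v c => μ c v) x
        rw [hval i, Nat.mod_eq_of_lt h1, hp, Nat.mod_eq_of_lt (by omega)]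
      · show μ (z[(i : ℕ)]'(hlt i)) ((z.take ((i : ℕ) + L)).foldl (fun v c => μ c v) x) =
          (z.take (((i + 1 : Fin (k + 1)) : ℕ) + L)).foldl (fun v c => μ c v) x
        rw [hval i, Nat.mod_eq_of_lt h1, hq, Nat.mod_eq_of_lt (by omega),
          show (i : ℕ) + L + 1 = (i : ℕ) + 1 + L by omega]
    · refine Or.inr ⟨?_, ?_⟩
      · show μ (z[(i : ℕ)]'(hlt i)) ((z.take i).foldl (fun v c => μ c v) x) =
          (z.take (((i + 1 : Fin (k + 1)) : ℕ) + L)).foldl (fun v c => μ c v) x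
        rw [hval i, h1, Nat.mod_self, Nat.zero_add, hp, Nat.mod_eq_of_lt (by omega), h1]
      · show μ (z[(i : ℕ)]'(hlt i)) ((z.take ((i : ℕ) + L)).foldl (fun v c => μ c v) x) =
          (z.take ((i + 1 : Fin (k + 1)) : ℕ)).foldl (fun v c => μ c v) x
        rw [hval i, h1, Nat.mod_self, hq, show (i : ℕ) + L + 1 = z.length by omega, Nat.mod_self]
  · -- consecutive colours differ, cyclically (at the wrap: `z[L - 1] ≠ z[L] = z[0]`)
    intro i
    rcases (show (i : ℕ) + 1 < L ∨ (i : ℕ) + 1 = L by have := i.isLt; omega) with h1 | h1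
    · have h := GoodTwin.cyclic_ne hchain i ((i : ℕ) + 1) (hlt i) (by omega)
        (by rw [Nat.mod_eq_of_lt (by omega)])
      have e : ((i + 1 : Fin (k + 1)) : ℕ) = (i : ℕ) + 1 := by rw [hval i, Nat.mod_eq_of_lt h1]
      show z[(i : ℕ)]'(hlt i) ≠ z[((i + 1 : Fin (k + 1)) : ℕ)]'(hlt (i + 1))
      intro hc
      apply h
      rw [hc]
      exact getElem_congr_idx e
    · have h := GoodTwin.cyclic_ne hchain i L (hlt i) (by omega)
        (by rw [h1.symm]; exact (Nat.mod_eq_of_lt (by omega)).symm)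
      have e : ((i + 1 : Fin (k + 1)) : ℕ) = 0 := by rw [hval i, h1, Nat.mod_self]
      have hz0 : z[(0 : ℕ)]'(by omega) = z[L]'(by omega) := by
        rw [hsym 0 (by omega)]; simp only [Nat.zero_add, Nat.mod_eq_of_lt (show L < z.length by omega)]
      show z[(i : ℕ)]'(hlt i) ≠ z[((i + 1 : Fin (k + 1)) : ℕ)]'(hlt (i + 1))
      intro hc
      apply h
      rw [hc, ← hz0]
      exact getElem_congr_idx e
  · -- rungs are pairwise equal or disjoint
    intro i j
    have hij := hpat ⟨i, hlt i⟩ ⟨j, hlt j⟩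
    have hiLj := hpat ⟨i, hlt i⟩ ⟨(j : ℕ) + L, hltL j⟩
    simp only [hmodL, hmod2L] at hij hiLj
    by_cases h1 : (z.take i).foldl (fun v c => μ c v) x = (z.take j).foldl (fun v c => μ c v) x
    · exact Or.inl ⟨h1, hij.1 h1⟩
    · by_cases h2 : (z.take i).foldl (fun v c => μ c v) x =
          (z.take ((j : ℕ) + L)).foldl (fun v c => μ c v) x
      · exact Or.inr (Or.inl ⟨h2, hiLj.1 h2⟩)
      · exact Or.inr (Or.inr ⟨h1, h2, fun h => h2 (hiLj.2 h), fun h => h1 (hij.2 h)⟩)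
  · -- all points avoid `R`
    intro i
    exact ⟨hR ⟨i, hlt i⟩, hR ⟨_, hltL i⟩⟩

/-- **Registered form `stub_patternHalfTurn`** (crux `stmt-MatrixMultiplication-10883`, helper stub of siege
seat k20): `patternHalfTurn_cleanWalk` for a square word `z = w ++ w` (`halfTurnForm_symm`). [folklore] -/
theorem stub_patternHalfTurn : ∀ (n : ℕ) (μ : Fin 3 → Equiv.Perm (Fin n)) (R : Finset (Fin n)) (w z : List (Fin 3)) (x : Fin n), z = w ++ w → 2 ≤ z.length → List.IsChain (· ≠ ·) (z ++ z) → z.foldl (fun v c => μ c v) x = x → (∀ s t : Fin z.length, ((z.take (s : ℕ)).foldl (fun v c => μ c v) x = (z.take (t : ℕ)).foldl (fun v c => μ c v) x ↔ (z.take (((s : ℕ) + w.length) % z.length)).foldl (fun v c => μ c v) x = (z.take (((t : ℕ) + w.length) % z.length)).foldl (fun v c => μ c v) x)) → (∀ t : Fin z.length, (z.take (t : ℕ)).foldl (fun v c => μ c v) x ≠ (z.take (((t : ℕ) + w.length) % z.length)).foldl (fun v c => μ c v) x) → (∀ t : Fin z.length, (z.take (t : ℕ)).foldl (fun v c => μ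 c v) x ∉ R) → ∃ (k : ℕ) (p q : Fin (k + 1) → Fin n) (col : Fin (k + 1) → Fin 3), (∀ i, p i ≠ q i) ∧ (∀ i, (μ (col i) (p i) = p (i + 1) ∧ μ (col i) (q i) = q (i + 1)) ∨ (μ (col i) (p i) = q (i + 1) ∧ μ (col i) (q i) = p (i + 1))) ∧ (∀ i, col i ≠ col (i + 1)) ∧ (∀ i j, (p i = p j ∧ q i = q j) ∨ (p i = q j ∧ q i = p j) ∨ (p i ≠ p j ∧ p i ≠ q j ∧ q i ≠ p j ∧ q i ≠ q j)) ∧ (∀ i, p i ∉ R ∧ q i ∉ R) ∧ 2 * (k + 1) = z.length := by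
  intro n μ R w z x hz hlen hchain hfix hpat hapart hR
  have hL : z.length = 2 * w.length := by rw [hz, List.length_append]; ring
  have hsym : ∀ t (ht : t < z.length),
      z[t] = z[(t + w.length) % z.length]'(Nat.mod_lt _ (by omega)) := by
    subst hz
    intro t ht
    exact PatternHalfTurn.halfTurnForm_symm w t ht
  exact patternHalfTurn_cleanWalk n μ R z w.length x hL hlen hchain hsym hfix hpat hapart hR

end Summit.MatrixMultiplication.MatrixMultiplication.Theorems.HyperoctahedralThreshold
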